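import Summits.ABC.ABC.Theorems.IsogenyGlueCongruencePolyDegreeOfBoundedPrimesManinRelativeDegree
import Summits.ABC.ABC.Theorems.IsogenyGlueCongruencePolyDegreeOfBoundedPrimesOfHeightAndManinItems
import HarnessLib

/-!
# Crux B (`PolyDegreeOfBoundedPrimes`, stmt-ABC-2046), line `Sketch` v7 — the MANIN-RELATIVE calibration, II:
# `Prel → M → P` by Zagier twice, and the split `B ↔ ((A → Prel) ∧ (A → SemistableManinBound2))`

Lead c5 (cycle 6, 2026-08-17); companion of `…ManinRelativeDegree` (notation there: `A`, `B`, `B'`, `P`, `H`, `M`, `SMB2`,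
and `Prel` = `∃ κ C, ∀ W semistable globally minimal, ∃ D, deg D ≤ C · c_D² · N_W^κ`). Requested in sketch form by the
route-choice planner (rchoice 8cb3b1b0, `RewirePolyDegreeManinRelative.lean`: `polyDegreeOfBoundedPrimes_of_split`, `…_of_split2`).

* `polyDegree_of_polyDegreeUpToManin_of_manin` — **`Prel → M → P`** with no height detour: the datum with the small Manin
  constant has small degree, because `deg D' = deg D · c_{D'}² / c_D²` (`modularDegree_eq_mul_sq_div_sq`, Zagier twice).
* `polyDegreeOfBoundedPrimes_of_split2 : (A → Prel) → SMB2 → B`, `polyDegreeOfBoundedPrimes_of_split : (A → Prel) → SMB → B`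
  (SMB = `SemistableManinBound`, stmt-ABC-16013; SMB2 = `SemistableManinBound2`, stmt-ABC-16014 — known-in-print support items).
* `polyDegreeOfBoundedPrimes_iff_polyDegreeUpToManin_and_semistableManinBound2` — **`B ↔ ((A → Prel) ∧ (A → SMB2))`**,
  hypothesis-free: crux B is its Manin-relative part (`= B'`, fact-free, file I) plus "crux A ⟹ the Manin item" (Carayol,
  `…OfHeightAndManinItems`), with no named fact anywhere in between.

No definition, no named fact, no `sorry`; supports stmt-ABC-2046.

## References

* D. Zagier, *Modular parametrizations of elliptic curves*, Canad. Math. Bull. 28 (1985), §1. [ZagierCMB1985]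
* H. Pasten, *Shimura curves and the abc conjecture*, J. Number Theory 254 (2024), §3 p. 13. [PastenShimura2024]
-/

noncomputable section

-- single-conjunct summit ABC: the duplicate ABC.ABC is mandated (CONVENTIONS §2)
set_option linter.dupNamespace false

namespace Summit.ABC.ABC.Theorems

open Literature.NumberTheory.EllipticCurves Literature.NumberTheory.EllipticCurves.ModularForms
open CongruenceSubgroup
open Summit.ABC.ABC.Theses.IsogenyGlueCongruence

/-! ## `Prel → M → P` by Zagier twice; crux B splits as `(A → Prel) ∧ (A → SMB2)` -/

/-- **`Prel → M → P` with no height detour**: if `W` has a datum `D` with `deg D ≤ C · c_D² · N^κ` and a datum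
`D'` with `|c_{D'}| ≤ M₀ · N^a`, then `deg D' = deg D · c_{D'}² / c_D² ≤ C · M₀² · N^{κ + 2a}` — the datum with
the small Manin constant has small degree (`modularDegree_eq_mul_sq_div_sq`). [cite: ZagierCMB1985, §1 (p. 374)] -/
theorem polyDegree_of_polyDegreeUpToManin_of_manin
    (hPrel : ∃ κ C : ℝ, ∀ (W : WeierstrassCurve ℚ) [W.IsElliptic] [W.IsGloballyMinimal]
      [NeZero (W.conductorNorm ℤ)], W.IsSemistable ℤ →
      ∃ D : ModularParametrizationData W (W.conductorNorm ℤ),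
        (D.modularDegree : ℝ) ≤ C * (D.maninConstant : ℝ) ^ 2 * (W.conductorNorm ℤ : ℝ) ^ κ)
    (hM : ∃ a M₀ : ℝ, ∀ (W : WeierstrassCurve ℚ) [W.IsElliptic] [W.IsGloballyMinimal]
      [NeZero (W.conductorNorm ℤ)], W.IsSemistable ℤ →
      ∃ D : ModularParametrizationData W (W.conductorNorm ℤ),
        |(D.maninConstant : ℝ)| ≤ M₀ * (W.conductorNorm ℤ : ℝ) ^ a) :
    ∃ κ C : ℝ, ∀ (W : WeierstrassCurve ℚ) [W.IsElliptic] [W.IsGloballyMinimal]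
      [NeZero (W.conductorNorm ℤ)], W.IsSemistable ℤ →
      ∃ D : ModularParametrizationData W (W.conductorNorm ℤ),
        (D.modularDegree : ℝ) ≤ C * (W.conductorNorm ℤ : ℝ) ^ κ := by
  obtain ⟨κ, C, hPrel⟩ := hPrel
  obtain ⟨a, M₀, hM⟩ := hM
  refine ⟨κ + 2 * max a 0, max C 0 * max M₀ 0 ^ 2, fun W _ _ _ hss ↦ ?_⟩
  obtain ⟨D, hD⟩ := hPrel W hss
  obtain ⟨D', hD'⟩ := hM W hss
  refine ⟨D', ?_⟩
  set N : ℕ := W.conductorNorm ℤ with hNdef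
  have hNpos : (0 : ℝ) < N := by exact_mod_cast Nat.pos_of_ne_zero (NeZero.ne N)
  have hN1 : (1 : ℝ) ≤ N := by exact_mod_cast Nat.pos_of_ne_zero (NeZero.ne N)
  have hc : (D.maninConstant : ℝ) ≠ 0 := by exact_mod_cast D.maninConstant_ne_zero_holds
  have hc2 : 0 < (D.maninConstant : ℝ) ^ 2 := by positivity
  -- `deg D' = deg D · c'² / c² ≤ C N^κ · c'²`
  have h1 : (D'.modularDegree : ℝ) ≤ max C 0 * (N : ℝ) ^ κ * (D'.maninConstant : ℝ) ^ 2 := by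
    rw [modularDegree_eq_mul_sq_div_sq D D', div_le_iff₀ hc2]
    have hNκ : (0 : ℝ) ≤ (D.maninConstant : ℝ) ^ 2 * (N : ℝ) ^ κ := by positivity
    calc (D.modularDegree : ℝ) * (D'.maninConstant : ℝ) ^ 2
        ≤ (C * (D.maninConstant : ℝ) ^ 2 * (N : ℝ) ^ κ) * (D'.maninConstant : ℝ) ^ 2 :=
          mul_le_mul_of_nonneg_right hD (sq_nonneg _)
      _ ≤ (max C 0 * ((D.maninConstant : ℝ) ^ 2 * (N : ℝ) ^ κ)) * (D'.maninConstant : ℝ) ^ 2 := by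
          rw [mul_assoc C]
          exact mul_le_mul_of_nonneg_right (mul_le_mul_of_nonneg_right (le_max_left _ _) hNκ)
            (sq_nonneg _)
      _ = max C 0 * (N : ℝ) ^ κ * (D'.maninConstant : ℝ) ^ 2 * (D.maninConstant : ℝ) ^ 2 := by ring
  -- `c'² ≤ (max M₀ 0)² · N^{2 max a 0}`
  have h2 : (D'.maninConstant : ℝ) ^ 2 ≤ (max M₀ 0) ^ 2 * (N : ℝ) ^ (2 * max a 0) := by
    have hNa : (N : ℝ) ^ a ≤ (N : ℝ) ^ (max a 0) :=
      Real.rpow_le_rpow_of_exponent_le hN1 (le_max_left _ _)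
    have hc' : |(D'.maninConstant : ℝ)| ≤ max M₀ 0 * (N : ℝ) ^ (max a 0) :=
      calc |(D'.maninConstant : ℝ)| ≤ M₀ * (N : ℝ) ^ a := hD'
        _ ≤ max M₀ 0 * (N : ℝ) ^ a := mul_le_mul_of_nonneg_right (le_max_left _ _) (by positivity)
        _ ≤ max M₀ 0 * (N : ℝ) ^ (max a 0) := mul_le_mul_of_nonneg_left hNa (le_max_right _ _)
    have hsq : |(D'.maninConstant : ℝ)| ^ 2 ≤ (max M₀ 0 * (N : ℝ) ^ (max a 0)) ^ 2 :=
      pow_le_pow_left₀ (abs_nonneg _) hc' 2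
    have hpow : ((N : ℝ) ^ (max a 0)) ^ 2 = (N : ℝ) ^ (2 * max a 0) := by
      rw [← Real.rpow_natCast, ← Real.rpow_mul hNpos.le]
      congr 1
      push_cast
      ring
    calc (D'.maninConstant : ℝ) ^ 2 = |(D'.maninConstant : ℝ)| ^ 2 := (sq_abs _).symm
      _ ≤ (max M₀ 0 * (N : ℝ) ^ (max a 0)) ^ 2 := hsq
      _ = (max M₀ 0) ^ 2 * (N : ℝ) ^ (2 * max a 0) := by rw [mul_pow, hpow]
  have hexp : (N : ℝ) ^ κ * (N : ℝ) ^ (2 * max a 0) = (N : ℝ) ^ (κ + 2 * max a 0) := by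
    rw [← Real.rpow_add hNpos]
  calc (D'.modularDegree : ℝ) ≤ max C 0 * (N : ℝ) ^ κ * (D'.maninConstant : ℝ) ^ 2 := h1
    _ ≤ max C 0 * (N : ℝ) ^ κ * ((max M₀ 0) ^ 2 * (N : ℝ) ^ (2 * max a 0)) :=
        mul_le_mul_of_nonneg_left h2 (by positivity)
    _ = max C 0 * (max M₀ 0) ^ 2 * ((N : ℝ) ^ κ * (N : ℝ) ^ (2 * max a 0)) := by ring
    _ = max C 0 * (max M₀ 0) ^ 2 * (N : ℝ) ^ (κ + 2 * max a 0) := by rw [hexp]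

/-- **`(A → Prel) → SMB2 → B`** (`polyDegreeOfBoundedPrimes_of_split2` in the planner's certificate): the
Manin-relative part of crux B plus the known-in-print support item `SemistableManinBound2` (stmt-ABC-16014) give
crux B, by Zagier twice — no height statement, no named fact. [cite: ZagierCMB1985, §1 (p. 374)] -/
theorem polyDegreeOfBoundedPrimes_of_split2
    (hrel : DegreePrimesPolyBounded → ∃ κ C : ℝ, ∀ (W : WeierstrassCurve ℚ) [W.IsElliptic]
      [W.IsGloballyMinimal] [NeZero (W.conductorNorm ℤ)], W.IsSemistable ℤ →
      ∃ D : ModularParametrizationData W (W.conductorNorm ℤ),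
        (D.modularDegree : ℝ) ≤ C * (D.maninConstant : ℝ) ^ 2 * (W.conductorNorm ℤ : ℝ) ^ κ)
    (hMan : SemistableManinBound2) : PolyDegreeOfBoundedPrimes :=
  fun hA ↦ polyDegree_of_polyDegreeUpToManin_of_manin (hrel hA)
    (maninData_of_semistableManinBound2_of_degreePrimes hMan hA)

/-- **`(A → Prel) → SMB → B`**, over the twin item `SemistableManinBound` (stmt-ABC-16013).
[cite: ZagierCMB1985, §1 (p. 374)] -/
theorem polyDegreeOfBoundedPrimes_of_split
    (hrel : DegreePrimesPolyBounded → ∃ κ C : ℝ, ∀ (W : WeierstrassCurve ℚ) [W.IsElliptic]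
      [W.IsGloballyMinimal] [NeZero (W.conductorNorm ℤ)], W.IsSemistable ℤ →
      ∃ D : ModularParametrizationData W (W.conductorNorm ℤ),
        (D.modularDegree : ℝ) ≤ C * (D.maninConstant : ℝ) ^ 2 * (W.conductorNorm ℤ : ℝ) ^ κ)
    (hMan : SemistableManinBound) : PolyDegreeOfBoundedPrimes :=
  polyDegreeOfBoundedPrimes_of_split2 hrel (semistableManinBound2_of_semistableManinBound hMan)

/-- **Exact split of crux B, hypothesis-free: `B ↔ ((A → Prel) ∧ (A → SMB2))`** — the Manin-relative part
(`= B'` by `polyHeightOfBoundedPrimes_iff_polyDegreeUpToManin`, fact-free) and the Manin part (`=` crux A ⟹ the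
known-in-print support item, by Carayol). `→`: `P → Prel` and `B → (A → SMB2)`
(`polyDegreeOfBoundedPrimes_iff_polyHeightOfBoundedPrimes_and_semistableManinBound2`); `←`: the split glue.
[cite: ZagierCMB1985, §1 (p. 374)] [cite: PastenShimura2024, §3 p. 13] -/
theorem polyDegreeOfBoundedPrimes_iff_polyDegreeUpToManin_and_semistableManinBound2 : Summit.ABC.ABC.Theses.IsogenyGlueCongruence.PolyDegreeOfBoundedPrimes ↔ ((Summit.ABC.ABC.Theses.IsogenyGlueCongruence.DegreePrimesPolyBounded → ∃ κ C : ℝ, ∀ (W : WeierstrassCurve ℚ) [W.IsElliptic] [W.IsGloballyMinimal] [NeZero (W.conductorNorm ℤ)], W.IsSemistable ℤ → ∃ D : Literature.NumberTheory.EllipticCurves.ModularForms.ModularParametrizationData W (W.conductorNorm ℤ), (D.modularDegree : ℝ) ≤ C * (D.maninConstant : ℝ) ^ 2 * (W.conductorNorm ℤ : ℝ) ^ κ) ∧ (Summit.ABC.ABC.Theses.IsogenyGlueCongruence.DegreePrimesPolyBounded → Summit.ABC.ABC.Theses.IsogenyGlueCongruence.SemistableManinBound2)) :=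
  ⟨fun hB ↦ ⟨fun hA ↦ polyDegreeUpToManin_of_polyDegree (hB hA),
      (polyDegreeOfBoundedPrimes_iff_polyHeightOfBoundedPrimes_and_semistableManinBound2.mp hB).2⟩,
    fun h hA ↦ polyDegree_of_polyDegreeUpToManin_of_manin (h.1 hA)
      (maninData_of_semistableManinBound2_of_degreePrimes (h.2 hA) hA)⟩

end Summit.ABC.ABC.Theorems

end
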